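import Literature.IUT.LogVolume.Teichmuller
import Literature.NumberTheory.GaloisRepresentations.PadicAlgClFiniteSubextensionDvr
import Literature.NumberTheory.EllipticCurves.NewformPadicIntegralModel
import HarnessLib

/-!
# Route `SignedLowerHalves`, crux L `SmallImageLowerHalfBothSigns` (stmt-BirchSwinnertonDyer-23599), line `rtt_w3` v15 — stub A bookkeeping (bk1, LEAD):
# THE TEICHMÜLLER CHARACTER `χ₀ = ω ∘ θ'` — the finite-order part of a continuous `𝒪ˣ`-valued character

WHY (RULING «U»; v15 stub `stub_charRoadFrame_ns` needs `χ₀` of finite order with `θ' = χ₀` on `Gal(K̄/K̃_∞)` (hker) and congruent to `θ'` mod `𝔪`). For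
`𝒪 = padicCoeffIntegers S` (`[ℚ_p(S):ℚ_p] < ∞`) and ANY continuous character `θ' : G →ₜ* 𝒪ˣ` of a topological group: ★★★ `exists_teichmullerCharacter` — a continuous
character `χ₀ : G →ₜ* 𝒪ˣ` with `χ₀^Q = 1` (`Q = q − 1`, `q = #(𝒪/𝔪)`, `p ∤ Q`), `‖χ₀ g − θ' g‖ < 1`, `χ₀ g = θ' g` whenever `θ' g` has finite order prime to `p`, and
`χ₀ g = 1` whenever `‖θ' g − 1‖ < 1`. Built from the Teichmüller representatives of `ℚ_p(S)` (tree: `Literature.IUT.LogVolume.exists_teichmuller`,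
`eq_one_of_pow_eq_one_of_not_dvd`, instantiated through the canonical normed-`ℚ_p`-algebra structure of `ℚ_p(S)`); `χ₀` is locally constant, hence continuous.
∃-form (theorems only). [cite: SerreLocalFields1979, Ch. II §4 Prop. 8] [cite: NeukirchANT1999, Ch. II (5.3)] [cite: Washington1997, §5.1 (Teichmüller character)]
-/

set_option autoImplicit false
-- the Theorems namespace of this sub repeats the summit name by design (D-0017 nested layout)
set_option linter.dupNamespace false

noncomputable section

open Literature.NumberTheory.EllipticCurves Literature.NumberTheory.GaloisRepresentations

namespace Summit.BirchSwinnertonDyer.BirchSwinnertonDyer.Theorems.SmallImageRttD2Twist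

section Teichmuller

variable {p : ℕ} [Fact p.Prime] (S : Set (PadicAlgCl p)) [FiniteDimensional ℚ_[p] (padicCoeffField S)]

/-- **Teichmüller representatives in `ℚ_p(S)`, with uniqueness**: there is `Q` with `0 < Q`, `p ∤ Q`, such that every `u` of norm `1` is within distance `< 1` of a
`Q`-th root of unity, and two roots of unity of orders prime to `p` within distance `< 1` are equal. [cite: NeukirchANT1999, Ch. II (5.3)] [cite: SerreLocalFields1979, Ch. II §4 Prop. 8] -/
theorem exists_teichmuller_exponent :
    ∃ Q : ℕ, 0 < Q ∧ ¬ p ∣ Q ∧ (∀ u : padicCoeffField S, ‖u‖ = 1 → ∃ ω : padicCoeffField S, ω ^ Q = 1 ∧ ‖ω - u‖ < 1) ∧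
      (∀ (ω₁ ω₂ : padicCoeffField S) (N : ℕ), ¬ p ∣ N → ω₁ ^ N = 1 → ω₂ ^ N = 1 → ‖ω₁ - ω₂‖ < 1 → ω₁ = ω₂) := by
  letI : NormedSpace ℚ_[p] (padicCoeffField S) :=
    { norm_smul_le := fun r x ↦ by
        change ‖((r • x : padicCoeffField S) : PadicAlgCl p)‖ ≤ ‖r‖ * ‖(x : PadicAlgCl p)‖
        rw [IntermediateField.coe_smul, norm_smul] }
  letI : NormedAlgebra ℚ_[p] (padicCoeffField S) := { norm_smul_le := norm_smul_le }
  haveI : IsUltrametricDist (padicCoeffField S) := Literature.NumberTheory.GaloisRepresentations.PadicAlgCl.isUltrametricDist (padicCoeffField S)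
  haveI : ProperSpace (padicCoeffField S) := FiniteDimensional.proper ℚ_[p] (padicCoeffField S)
  refine ⟨p ^ Literature.IUT.LogVolume.residueDegree p (padicCoeffField S) - 1,
    Nat.pos_of_ne_zero (Literature.IUT.LogVolume.residueCard_sub_one_ne_zero p (padicCoeffField S)),
    Literature.IUT.LogVolume.not_dvd_residueCard_sub_one p (padicCoeffField S),
    fun u hu ↦ Literature.IUT.LogVolume.exists_teichmuller p (padicCoeffField S) hu, fun ω₁ ω₂ N hN h₁ h₂ hd ↦ ?_⟩
  -- uniqueness: `ζ := ω₁ / ω₂` is an `N`-th root of unity with `‖1 − ζ‖ < 1`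
  have hN0 : N ≠ 0 := by rintro rfl; exact hN (dvd_zero p)
  have hω₂0 : ω₂ ≠ 0 := by
    rintro rfl
    rw [zero_pow hN0] at h₂
    exact zero_ne_one h₂
  have hω₂1 : ‖ω₂‖ = 1 := by
    have h := congrArg norm h₂
    rw [norm_pow, norm_one] at h
    exact (pow_eq_one_iff_of_nonneg (norm_nonneg _) hN0).mp h
  have hζ : (ω₁ / ω₂) ^ N = 1 := by rw [div_pow, h₁, h₂, div_one]
  have h1 : ‖1 - ω₁ / ω₂‖ < 1 := by
    rw [show (1 : padicCoeffField S) - ω₁ / ω₂ = (ω₂ - ω₁) / ω₂ by field_simp, norm_div, hω₂1, div_one, norm_sub_rev]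
    exact hd
  have := Literature.IUT.LogVolume.eq_one_of_pow_eq_one_of_not_dvd p (padicCoeffField S) hN hζ h1
  rwa [div_eq_one_iff_eq hω₂0] at this

omit [FiniteDimensional ℚ_[p] (padicCoeffField S)] in
/-- An element of `𝒪 = padicCoeffIntegers S` lies in `ℚ_p(S)`. [folklore] -/
theorem mem_padicCoeffField_of_mem (x : padicCoeffIntegers S) : (x : PadicAlgCl p) ∈ padicCoeffField S :=
  ((mem_padicCoeffIntegers_iff S _).mp x.2).1

omit [FiniteDimensional ℚ_[p] (padicCoeffField S)] in
/-- Units of `𝒪` have norm `1`. [folklore] -/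
theorem norm_coe_unit (u : (padicCoeffIntegers S)ˣ) : ‖((u : padicCoeffIntegers S) : PadicAlgCl p)‖ = 1 := by
  have h1 : ‖((u : padicCoeffIntegers S) : PadicAlgCl p)‖ ≤ 1 := ((mem_padicCoeffIntegers_iff S _).mp (u : padicCoeffIntegers S).2).2
  have h2 : ‖(((u⁻¹ : (padicCoeffIntegers S)ˣ) : padicCoeffIntegers S) : PadicAlgCl p)‖ ≤ 1 :=
    ((mem_padicCoeffIntegers_iff S _).mp ((u⁻¹ : (padicCoeffIntegers S)ˣ) : padicCoeffIntegers S).2).2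
  have h12 : ‖((u : padicCoeffIntegers S) : PadicAlgCl p)‖ * ‖(((u⁻¹ : (padicCoeffIntegers S)ˣ) : padicCoeffIntegers S) : PadicAlgCl p)‖ = 1 := by
    rw [← norm_mul, ← Subring.coe_mul, ← Units.val_mul, mul_inv_cancel, Units.val_one, Subring.coe_one, norm_one]
  refine le_antisymm h1 ?_
  calc (1 : ℝ) = ‖((u : padicCoeffIntegers S) : PadicAlgCl p)‖ * ‖(((u⁻¹ : (padicCoeffIntegers S)ˣ) : padicCoeffIntegers S) : PadicAlgCl p)‖ := h12.symm
    _ ≤ ‖((u : padicCoeffIntegers S) : PadicAlgCl p)‖ * 1 := by gcongr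
    _ = _ := mul_one _

/-- ★★★ **The Teichmüller character.** See the module docstring. [cite: SerreLocalFields1979, Ch. II §4 Prop. 8] [cite: Washington1997, §5.1] -/
theorem exists_teichmullerCharacter {G : Type*} [Group G] [TopologicalSpace G] (θ' : G →ₜ* (padicCoeffIntegers S)ˣ) :
    ∃ (χ₀ : G →ₜ* (padicCoeffIntegers S)ˣ) (Q : ℕ), 0 < Q ∧ ¬ p ∣ Q ∧ (∀ g, χ₀ g ^ Q = 1) ∧
      (∀ g, ‖((χ₀ g : padicCoeffIntegers S) : PadicAlgCl p) - ((θ' g : padicCoeffIntegers S) : PadicAlgCl p)‖ < 1) ∧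
      (∀ (g : G) (N : ℕ), ¬ p ∣ N → θ' g ^ N = 1 → χ₀ g = θ' g) ∧
      (∀ g : G, ‖((θ' g : padicCoeffIntegers S) : PadicAlgCl p) - 1‖ < 1 → χ₀ g = 1) := by
  obtain ⟨Q, hQ0, hQp, hex, huniq⟩ := exists_teichmuller_exponent S
  -- the embedding `𝒪ˣ → ℚ̄_p` and its algebra
  let ι : (padicCoeffIntegers S)ˣ → PadicAlgCl p := fun u ↦ ((u : padicCoeffIntegers S) : PadicAlgCl p)
  have hιmul : ∀ u v, ι (u * v) = ι u * ι v := fun u v ↦ by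
    change (((u * v : (padicCoeffIntegers S)ˣ) : padicCoeffIntegers S) : PadicAlgCl p) = _
    rw [Units.val_mul, Subring.coe_mul]
  have hι1 : ι 1 = 1 := by change (((1 : (padicCoeffIntegers S)ˣ) : padicCoeffIntegers S) : PadicAlgCl p) = 1; rw [Units.val_one, Subring.coe_one]
  have hιpow : ∀ (u : (padicCoeffIntegers S)ˣ) (n : ℕ), ι (u ^ n) = ι u ^ n := fun u n ↦ by
    change (((u ^ n : (padicCoeffIntegers S)ˣ) : padicCoeffIntegers S) : PadicAlgCl p) = _
    rw [Units.val_pow_eq_pow_val, Subring.coe_pow]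
  have hιnorm : ∀ u, ‖ι u‖ = 1 := norm_coe_unit S
  have hιmem : ∀ u, ι u ∈ padicCoeffField S := fun u ↦ mem_padicCoeffField_of_mem S _
  -- transfer to `E = ℚ_p(S)`: `ιE u := ⟨ι u, _⟩`
  let ιE : (padicCoeffIntegers S)ˣ → padicCoeffField S := fun u ↦ ⟨ι u, hιmem u⟩
  have hιEpow : ∀ (u : (padicCoeffIntegers S)ˣ) (n : ℕ), u ^ n = 1 → ιE u ^ n = 1 := fun u n h ↦ by
    apply Subtype.ext
    rw [SubmonoidClass.mk_pow]
    change ι u ^ n = ((1 : padicCoeffField S) : PadicAlgCl p)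
    rw [← hιpow, h, hι1, OneMemClass.coe_one]
  -- the representative of a unit of `𝒪`, as a unit of `𝒪`
  have hrep : ∀ u : (padicCoeffIntegers S)ˣ, ∃ ω : (padicCoeffIntegers S)ˣ, ω ^ Q = 1 ∧ ‖ι ω - ι u‖ < 1 := fun u ↦ by
    obtain ⟨ω, hωQ, hωu⟩ := hex (ιE u) (hιnorm u)
    have hωQ' : (ω : PadicAlgCl p) ^ Q = 1 := by
      have := congrArg (fun x : padicCoeffField S ↦ (x : PadicAlgCl p)) hωQ
      simpa only [IntermediateField.coe_pow, OneMemClass.coe_one] using this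
    have hω1 : ‖(ω : PadicAlgCl p)‖ = 1 := by
      have h := congrArg norm hωQ'
      rw [norm_pow, norm_one] at h
      exact (pow_eq_one_iff_of_nonneg (norm_nonneg _) hQ0.ne').mp h
    have hωO : (ω : PadicAlgCl p) ∈ padicCoeffIntegers S := (mem_padicCoeffIntegers_iff S _).mpr ⟨ω.2, hω1.le⟩
    have hpowO : (⟨(ω : PadicAlgCl p), hωO⟩ : padicCoeffIntegers S) ^ Q = 1 :=
      Subtype.ext (by rw [SubmonoidClass.mk_pow]; exact hωQ')
    refine ⟨Units.ofPowEqOne _ Q hpowO hQ0.ne', ?_, ?_⟩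
    · exact Units.ext (by rw [Units.val_pow_eq_pow_val, Units.val_ofPowEqOne, hpowO, Units.val_one])
    · exact hωu
  choose ω hωQ hωu using hrep
  -- uniqueness transported to `𝒪ˣ`
  have huniqO : ∀ (ω₁ ω₂ : (padicCoeffIntegers S)ˣ) (N : ℕ), ¬ p ∣ N → ω₁ ^ N = 1 → ω₂ ^ N = 1 → ‖ι ω₁ - ι ω₂‖ < 1 → ω₁ = ω₂ := by
    intro ω₁ ω₂ N hN h₁ h₂ hd
    have key := huniq (ιE ω₁) (ιE ω₂) N hN (hιEpow ω₁ N h₁) (hιEpow ω₂ N h₂) hd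
    exact Units.ext (Subtype.ext (congrArg (fun x : padicCoeffField S ↦ (x : PadicAlgCl p)) key))
  -- ultrametric three-point estimate
  have tri : ∀ a b c : PadicAlgCl p, ‖a - b‖ < 1 → ‖b - c‖ < 1 → ‖a - c‖ < 1 := fun a b c hab hbc ↦ by
    rw [show a - c = (a - b) + (b - c) by ring]
    exact (IsUltrametricDist.norm_add_le_max _ _).trans_lt (max_lt hab hbc)
  -- multiplicativity by uniqueness
  have hmul : ∀ g h : G, ω (θ' (g * h)) = ω (θ' g) * ω (θ' h) := by
    intro g h
    refine huniqO _ _ Q hQp (hωQ _) (by rw [mul_pow, hωQ, hωQ, one_mul]) ?_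
    refine tri _ (ι (θ' (g * h))) _ (hωu _) ?_
    rw [map_mul, hιmul, hιmul]
    -- `uv − ω_u ω_v = u (v − ω_v) + (u − ω_u) ω_v`
    rw [show ι (θ' g) * ι (θ' h) - ι (ω (θ' g)) * ι (ω (θ' h)) =
        ι (θ' g) * (ι (θ' h) - ι (ω (θ' h))) + (ι (θ' g) - ι (ω (θ' g))) * ι (ω (θ' h)) by ring]
    refine (IsUltrametricDist.norm_add_le_max _ _).trans_lt (max_lt ?_ ?_)
    · rw [norm_mul, hιnorm, one_mul, norm_sub_rev]; exact hωu (θ' h)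
    · rw [norm_mul, hιnorm, mul_one, norm_sub_rev]; exact hωu (θ' g)
  have hone : ω (θ' 1) = 1 := by
    refine huniqO _ _ Q hQp (hωQ _) (one_pow Q) ?_
    have h := hωu (θ' 1)
    have h1 : θ' 1 = 1 := map_one θ'
    rw [h1] at h ⊢
    exact h
  -- the character, locally constant hence continuous
  let χ : G →* (padicCoeffIntegers S)ˣ := { toFun := fun g ↦ ω (θ' g), map_one' := hone, map_mul' := hmul }
  have hcont : Continuous fun g : G ↦ ι (θ' g) := continuous_subtype_val.comp (Units.continuous_val.comp θ'.continuous_toFun)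
  have hloc : IsLocallyConstant χ := by
    refine (IsLocallyConstant.iff_exists_open χ).mpr fun g ↦ ?_
    refine ⟨(fun h : G ↦ ι (θ' h)) ⁻¹' Metric.ball (ι (θ' g)) 1, Metric.isOpen_ball.preimage hcont, Metric.mem_ball_self one_pos,
      fun h hh ↦ ?_⟩
    rw [Set.mem_preimage, Metric.mem_ball, dist_eq_norm] at hh
    change ω (θ' h) = ω (θ' g)
    refine huniqO _ _ Q hQp (hωQ _) (hωQ _) (tri _ (ι (θ' h)) _ (hωu _) (tri _ (ι (θ' g)) _ hh ?_))
    rw [norm_sub_rev]; exact hωu _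
  let χ₀ : G →ₜ* (padicCoeffIntegers S)ˣ := { χ with continuous_toFun := hloc.continuous }
  refine ⟨χ₀, Q, hQ0, hQp, fun g ↦ hωQ _, fun g ↦ hωu _, fun g N hN hgN ↦ ?_, fun g hg ↦ ?_⟩
  · -- `θ' g` itself is a root of unity of order prime to `p`
    change ω (θ' g) = θ' g
    refine huniqO _ _ (Q * N) (fun hd ↦ ((Nat.Prime.dvd_mul Fact.out).mp hd).elim hQp hN) ?_ ?_ (hωu _)
    · rw [pow_mul, hωQ, one_pow]
    · rw [mul_comm, pow_mul, hgN, one_pow]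
  · change ω (θ' g) = 1
    refine huniqO _ _ Q hQp (hωQ _) (one_pow Q) ?_
    rw [hι1]
    exact tri _ (ι (θ' g)) _ (hωu _) hg

end Teichmuller

end Summit.BirchSwinnertonDyer.BirchSwinnertonDyer.Theorems.SmallImageRttD2Twist

end
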